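import Literature.NumberTheory.EllipticCurves.CuspFormLFunction
import Literature.NumberTheory.EllipticCurves.RankinSelbergBilinearStrip
import HarnessLib

/-!
# Cusp forms on `Γ₀(N)` as `q`-series: coefficient bounds and a global growth bound

Topic `Literature/NumberTheory/EllipticCurves`; namespace
`Literature.NumberTheory.EllipticCurves.ModularForms`. Theorems only; no definition, no named fact.

The elementary facts about a cusp form `f ∈ S_k(Γ₀(N))` (`k ≥ 0`) that the Rankin–Selberg files
(`RankinSelbergWeightOneStrip`, `RankinSelbergWeightOneIdentity`) take as hypotheses on the
weight-`2` factor, discharged from Mathlib: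

* `hasSum_cuspCoeff_exp`, `cuspForm_eq_qSeries`, `cuspCoeff_zero_eq` — `f(τ) = Σ_{m ≥ 1} a_m(f)
  e^{2πimτ}` as the tree's `qSeries (cuspCoeff f)` (Mathlib `hasSum_qExpansion`,
  `CuspFormClass.qExpansion_coeff_zero`; `cuspCoeff` of `CuspFormLFunction`);
* `exists_norm_cuspCoeff_le` — a polynomial bound `|a_m(f)| ≤ C (m+1)^{k}` (Hecke's bound
  `a_m = O(m^{k/2})`, Mathlib `CuspFormClass.qExpansion_isBigO`, made global in `m`);
* `exists_norm_le_exp_mul` — **the global growth bound**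
  `|f(τ)| ≤ C e^{-2π Im τ} (1 + (Im τ)^{-k/2})` on all of `ℍ` (exponential decay at `i∞` with the
  sharp rate `2π`, Mathlib `CuspFormClass.exp_decay_atImInfty` for the strict period `1`, and
  `|f(τ)| ≤ C (Im τ)^{-k/2}`, `CuspFormClass.exists_bound`, below the decay height);
* `cuspForm_smul_eq_denom_sq_mul` — `f(Aτ) = j(A, τ)² f(τ)` for `A ∈ Γ₀(N)` in weight `2`.

Everything is proved. [folklore] (Diamond–Shurman §1.1, §5.9.)

## References

* F. Diamond, J. Shurman, *A First Course in Modular Forms*, GTM 228, §1.1 and Prop. 5.9.1.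
-/

noncomputable section

open scoped MatrixGroups ModularForm Real Topology
open UpperHalfPlane hiding I
open Filter Asymptotics CongruenceSubgroup Complex Finset

namespace Literature.NumberTheory.EllipticCurves.ModularForms

variable {N : ℕ} {k : ℤ}

/-- `1` is a strict period of `Γ₀(N)` (cf. the tree's `one_mem_strictPeriods_Gamma0` in
`TwistedLValueSeries`, not imported here to keep the import closure small). [folklore] -/
private theorem one_mem_strictPeriods_Gamma0' (N : ℕ) :
    (1 : ℝ) ∈ (Gamma0 N : Subgroup (GL (Fin 2) ℝ)).strictPeriods :=
  strictWidthInfty_Gamma0 N ▸ Subgroup.strictWidthInfty_mem_strictPeriods _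

/-! ### The `q`-expansion as a `q`-series -/

/-- **`f(τ) = Σ a_m(f) e^{2πimτ}`** for `f ∈ S_k(Γ₀(N))` (Mathlib `hasSum_qExpansion` with the strict
period `1`). [folklore] -/
theorem hasSum_cuspCoeff_exp (f : CuspForm (Gamma0 N) k) (τ : ℍ) :
    HasSum (fun m : ℕ => cuspCoeff f m * Complex.exp (2 * π * Complex.I * m * τ)) (f τ) := by
  have hΓ := one_mem_strictPeriods_Gamma0' N
  haveI : Fact (IsCusp OnePoint.infty (Gamma0 N : Subgroup (GL (Fin 2) ℝ))) :=
    ⟨Subgroup.isCusp_of_mem_strictPeriods one_pos hΓ⟩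
  have h := UpperHalfPlane.hasSum_qExpansion one_pos
    (SlashInvariantFormClass.periodic_comp_ofComplex f hΓ) (ModularFormClass.holo f)
    (ModularFormClass.bdd_at_infty f) τ
  refine h.congr_fun fun m => ?_
  rw [smul_eq_mul, Function.Periodic.qParam, ← Complex.exp_nat_mul]
  congr 1
  congr 1
  push_cast
  ring

/-- `f = qSeries (cuspCoeff f)` pointwise on `ℍ`. [folklore] -/
theorem cuspForm_eq_qSeries (f : CuspForm (Gamma0 N) k) (τ : ℍ) :
    f τ = qSeries (cuspCoeff f) τ :=
  ((hasSum_cuspCoeff_exp f τ).tsum_eq).symm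

/-- `a₀(f) = 0` for a cusp form on `Γ₀(N)`. [folklore] -/
theorem cuspCoeff_zero_eq (f : CuspForm (Gamma0 N) k) : cuspCoeff f 0 = 0 :=
  CuspFormClass.qExpansion_coeff_zero f one_pos (one_mem_strictPeriods_Gamma0' N)

/-! ### A global polynomial bound on the coefficients -/

/-- **Polynomial bound on the Fourier coefficients**: for `f ∈ S_k(Γ₀(N))`, `k ≥ 0`, there is `C`
with `|a_m(f)| ≤ C (m+1)^{k}` for all `m` (Hecke's bound `a_m = O(m^{k/2})`, Mathlib
`CuspFormClass.qExpansion_isBigO`, eventually in `m`; the finitely many small `m` are absorbed in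
the constant, and `m^{k/2} ≤ (m+1)^{k}`). [folklore] -/
theorem exists_norm_cuspCoeff_le [NeZero N] (f : CuspForm (Gamma0 N) k) (hk : 0 ≤ k) :
    ∃ C : ℝ, ∀ m : ℕ, ‖cuspCoeff f m‖ ≤ C * ((m : ℝ) + 1) ^ k.toNat := by
  obtain ⟨c, hc⟩ := (CuspFormClass.qExpansion_isBigO f).bound
  rw [strictWidthInfty_Gamma0] at hc
  obtain ⟨n₀, hn₀⟩ := eventually_atTop.mp hc
  set S : ℝ := ∑ n ∈ range n₀, ‖cuspCoeff f n‖ with hS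
  have hS0 : 0 ≤ S := sum_nonneg fun n _ => norm_nonneg _
  have hkR : ((k.toNat : ℕ) : ℝ) = (k : ℝ) := by
    have h := Int.toNat_of_nonneg hk
    exact_mod_cast h
  have hk0 : (0 : ℝ) ≤ (k : ℝ) := by exact_mod_cast hk
  refine ⟨max c 0 + S, fun m => ?_⟩
  have hm0 : (0 : ℝ) ≤ m := Nat.cast_nonneg m
  have hpow : (1 : ℝ) ≤ ((m : ℝ) + 1) ^ k.toNat := one_le_pow₀ (by linarith)
  by_cases hm : n₀ ≤ m
  · have h := hn₀ m hm
    change ‖cuspCoeff f m‖ ≤ c * ‖(m : ℝ) ^ ((k : ℝ) / 2)‖ at h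
    have h2 : ‖(m : ℝ) ^ ((k : ℝ) / 2)‖ ≤ ((m : ℝ) + 1) ^ k.toNat := by
      rw [Real.norm_of_nonneg (Real.rpow_nonneg hm0 _)]
      calc (m : ℝ) ^ ((k : ℝ) / 2) ≤ ((m : ℝ) + 1) ^ ((k : ℝ) / 2) :=
            Real.rpow_le_rpow hm0 (by linarith) (by positivity)
        _ ≤ ((m : ℝ) + 1) ^ ((k.toNat : ℕ) : ℝ) :=
            Real.rpow_le_rpow_of_exponent_le (by linarith) (by rw [hkR]; linarith)
        _ = ((m : ℝ) + 1) ^ k.toNat := Real.rpow_natCast _ _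
    calc ‖cuspCoeff f m‖ ≤ c * ‖(m : ℝ) ^ ((k : ℝ) / 2)‖ := h
      _ ≤ max c 0 * ((m : ℝ) + 1) ^ k.toNat :=
          mul_le_mul (le_max_left _ _) h2 (norm_nonneg _) (le_max_right _ _)
      _ ≤ (max c 0 + S) * ((m : ℝ) + 1) ^ k.toNat := by
          gcongr
          linarith
  · push Not at hm
    have h1 : ‖cuspCoeff f m‖ ≤ S :=
      single_le_sum (f := fun n => ‖cuspCoeff f n‖) (fun _ _ => norm_nonneg _) (mem_range.mpr hm)
    calc ‖cuspCoeff f m‖ ≤ S := h1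
      _ ≤ (max c 0 + S) * 1 := by linarith [le_max_right c 0]
      _ ≤ (max c 0 + S) * ((m : ℝ) + 1) ^ k.toNat :=
          mul_le_mul_of_nonneg_left hpow (by positivity)

/-! ### A global growth bound -/

/-- **Global growth of a cusp form**: for `f ∈ S_k(Γ₀(N))` there is `C ≥ 0` with
`|f(τ)| ≤ C e^{-2π Im τ} (1 + (Im τ)^{-k/2})` for all `τ ∈ ℍ` (exponential decay with rate `2π`
above some height `A` by Mathlib `CuspFormClass.exp_decay_atImInfty` for the strict period `1`;
below it `|f(τ)| ≤ C' (Im τ)^{-k/2}`, `CuspFormClass.exists_bound`, and `e^{2πA} e^{-2π Im τ} ≥ 1`).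
[folklore] -/
theorem exists_norm_le_exp_mul [NeZero N] (f : CuspForm (Gamma0 N) k) :
    ∃ C : ℝ, 0 ≤ C ∧ ∀ τ : ℍ,
      ‖f τ‖ ≤ C * Real.exp (-(2 * π * τ.im)) * (1 + τ.im ^ (-((k : ℝ) / 2))) := by
  have hΓ := one_mem_strictPeriods_Gamma0' N
  obtain ⟨C₁, hC₁⟩ := (CuspFormClass.exp_decay_atImInfty f one_pos hΓ).bound
  obtain ⟨A, hA⟩ := (UpperHalfPlane.atImInfty_mem _).mp hC₁
  obtain ⟨C₂, hC₂⟩ := CuspFormClass.exists_bound f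
  set A' : ℝ := max A 0 with hA'
  refine ⟨max C₁ 0 + max C₂ 0 * Real.exp (2 * π * A'), by positivity, fun τ => ?_⟩
  have hy : 0 < τ.im := τ.im_pos
  have he : 0 < Real.exp (-(2 * π * τ.im)) := Real.exp_pos _
  have hp : 0 ≤ τ.im ^ (-((k : ℝ) / 2)) := Real.rpow_nonneg hy.le _
  have h1le : (1 : ℝ) ≤ 1 + τ.im ^ (-((k : ℝ) / 2)) := by linarith
  by_cases hcase : A ≤ τ.im
  · have h := hA τ hcase
    simp only [Set.mem_setOf_eq, div_one, Real.norm_eq_abs, abs_of_pos (Real.exp_pos _)] at h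
    -- h : ‖f τ‖ ≤ C₁ * rexp (-2 * π * τ.im)
    have h' : ‖f τ‖ ≤ max C₁ 0 * Real.exp (-(2 * π * τ.im)) := by
      rw [show -(2 * π * τ.im) = -2 * π * τ.im by ring]
      exact h.trans (mul_le_mul_of_nonneg_right (le_max_left _ _) (Real.exp_pos _).le)
    calc ‖f τ‖ ≤ max C₁ 0 * Real.exp (-(2 * π * τ.im)) := h'
      _ ≤ max C₁ 0 * Real.exp (-(2 * π * τ.im)) * (1 + τ.im ^ (-((k : ℝ) / 2))) :=
          le_mul_of_one_le_right (by positivity) h1le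
      _ ≤ (max C₁ 0 + max C₂ 0 * Real.exp (2 * π * A')) * Real.exp (-(2 * π * τ.im)) *
            (1 + τ.im ^ (-((k : ℝ) / 2))) := by
          gcongr
          have : 0 ≤ max C₂ 0 * Real.exp (2 * π * A') := by positivity
          linarith
  · push Not at hcase
    have hle : τ.im ≤ A' := hcase.le.trans (le_max_left _ _)
    have h := hC₂ τ
    -- `‖f τ‖ ≤ C₂ / y^{k/2} = C₂ y^{-k/2}`
    have h' : ‖f τ‖ ≤ max C₂ 0 * τ.im ^ (-((k : ℝ) / 2)) := by
      rw [Real.rpow_neg hy.le, ← div_eq_mul_inv]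
      exact h.trans (div_le_div_of_nonneg_right (le_max_left _ _) (Real.rpow_nonneg hy.le _))
    have hexp : (1 : ℝ) ≤ Real.exp (2 * π * A') * Real.exp (-(2 * π * τ.im)) := by
      rw [← Real.exp_add]
      exact Real.one_le_exp (by nlinarith [Real.pi_pos])
    calc ‖f τ‖ ≤ max C₂ 0 * τ.im ^ (-((k : ℝ) / 2)) := h'
      _ ≤ max C₂ 0 * τ.im ^ (-((k : ℝ) / 2)) * (Real.exp (2 * π * A') * Real.exp (-(2 * π * τ.im))) :=
          le_mul_of_one_le_right (by positivity) hexp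
      _ = max C₂ 0 * Real.exp (2 * π * A') * Real.exp (-(2 * π * τ.im)) * τ.im ^ (-((k : ℝ) / 2)) := by
          ring
      _ ≤ max C₂ 0 * Real.exp (2 * π * A') * Real.exp (-(2 * π * τ.im)) *
            (1 + τ.im ^ (-((k : ℝ) / 2))) := by
          gcongr
          linarith
      _ ≤ (max C₁ 0 + max C₂ 0 * Real.exp (2 * π * A')) * Real.exp (-(2 * π * τ.im)) *
            (1 + τ.im ^ (-((k : ℝ) / 2))) := by
          gcongr
          linarith [le_max_right C₁ 0]

/-! ### Automorphy in the `denom` normalisation -/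

/-- `f(Aτ) = j(A, τ)² f(τ)` for `f ∈ S₂(Γ₀(N))` and `A ∈ Γ₀(N)` (Mathlib
`SlashInvariantForm.slash_action_eqn_SL''`). [folklore] -/
theorem cuspForm_smul_eq_denom_sq_mul (f : CuspForm (Gamma0 N) 2) {A : SL(2, ℤ)}
    (hA : A ∈ Gamma0 N) (τ : ℍ) : f (A • τ) = denom A τ ^ 2 * f τ := by
  have h := SlashInvariantForm.slash_action_eqn_SL'' f hA τ
  rw [h, zpow_two, pow_two]

/-- Measurability of a cusp form (it is holomorphic, hence continuous). [folklore] -/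
theorem measurable_cuspForm (f : CuspForm (Gamma0 N) k) : Measurable (⇑f : ℍ → ℂ) :=
  (ModularFormClass.holo f).continuous.measurable

end Literature.NumberTheory.EllipticCurves.ModularForms
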